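import Mathlib.LinearAlgebra.SymmetricAlgebra.Basis
import Mathlib.RingTheory.Kaehler.JacobiZariski
import Mathlib.RingTheory.Smooth.Basic
import Mathlib.RingTheory.Smooth.Kaehler
import Mathlib.RingTheory.FinitePresentation
import Mathlib.RingTheory.FiniteType
import Mathlib.LinearAlgebra.TensorProduct.Prod
import Mathlib.RingTheory.Extension.Cotangent.Basic
import Mathlib.RingTheory.Etale.Kaehler
import Mathlib.RingTheory.Flat.Localization
import Mathlib.RingTheory.Localization.BaseChange
import Literature.AlgebraicGeometry.Resolution.NeronPopescuLocalTricks
import Literature.AlgebraicGeometry.Resolution.StrictlyStandardPowers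
import HarnessLib

/-!
# Improving presentations: the symmetric algebra of the conormal module (Stacks 07CE)

Topic: `Literature/AlgebraicGeometry/Resolution`. The Stacks Project, *Smoothing Ring Maps*
(Tag 07BW), Lemma 07CE (= Lemma 16.3.1, "improve presentation"), in the form used by the proof
of Lemma 07FE (`Stacks07FE_resolveSpecial`, `NeronPopescuSteps.lean`):

> **Lemma 07CE.** Let `R` be a ring and let `A` be a finitely presented `R`-algebra. There
> exists finite type `R`-algebra map `A → C` which has a retraction with the following two
> properties: (1) for each `a ∈ A` such that `R → A_a` is a local complete intersection the ring
> `C_a` is smooth over `A_a` and has a presentation `C_a = R[y_1, …, y_m]/J` such that `J/J²` is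
> free over `C_a`, and (2) for each `a ∈ A` such that `A_a` is smooth over `R` the module
> `Ω_{C_a/R}` is free over `C_a`.

(The text before the lemma: "Note that the algebra `C` in the following lemma is a symmetric
algebra over `A`. Moreover, if `R` is Noetherian, then `C` is of finite presentation over `R`.")
We construct `C = Sym*_A(I/I²)` for a finite presentation `A = R[x_1, …, x_n]/I` exactly as in
the printed proof and prove: `C` is of finite type over `R` (of finite presentation if `R` is
Noetherian), `A → C` has a retraction, and **for `a ∈ A` with `A_a` smooth over `R`, `C_a` is
smooth over `A_a` (indeed over `R`) and `Ω_{C_a/R}` is free over `C_a`** — i.e. part (2) and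
the smoothness assertion of part (1) in the smooth case, which is all that 07FE uses ("Each
`B_{a_j}` is smooth over `R` … Hence `B_{x_i}` is smooth over `R`. Let `B → C` be the `R`-algebra
map constructed in Lemma 07CE … By construction `C_{x_i}` is a smooth `R`-algebra with
`Ω_{C_{x_i}/R}` free"). The presentation-level assertion of (1) (`J/J²` free) and the lci case
are not treated. Packaged statement: `Stacks07CE_exists_symmetricAlgebra`.

## Proof and its rendering

Stacks computes, for the explicit presentation of `C`, that `Ω_{C_a/R}` is the module
`I/I² ⊗_A C_a ⊕ Ω_{A_a/R} ⊗_{A_a} C_a` and concludes by "Since `(I/I²)_a ⊕ Ω_{A_a/R}` is free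
(from the definition of smooth ring maps) we see that (2) holds." We obtain the same
decomposition structurally:

* Section I (`SymAlg`, for any `IsSymmetricAlgebra f`, `f : N → A` over `S`): `A` is generated
  by `f(N)` (finite type for finite `N`); for `N` finite projective, `A` is a retract of a
  polynomial algebra `S[X_1, …, X_k]` (`exists_retract_mvPolynomial`), hence formally smooth
  (`formallySmooth`, using `formallySmooth_of_retract`), and `A ⊗_S N → Ω_{A/S}`,
  `a ⊗ n ↦ a d f(n)` is bijective (`toKaehler_bijective`: both sides are retracts of the
  polynomial case, compatibly with the Kähler functoriality maps, and for `S[X] = Sym(S^k)` the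
  map is `e_j ↦ dX_j`); and `C_a` is a symmetric algebra of the `A_a`-module `A_a ⊗_A (I/I²)`
  (`isSymmetricAlgebra_locMap`: symmetric algebras commute with the base change `A → A_a`).
* Section II: with `(I/I²)_a ⊕ (A_a ⊗ Ω_{A/R})` free (`Stacks07EZ.free_locCot_prod`, the split
  conormal sequence of the smooth algebra `A_a`, `StrictlyStandardPowers.lean`), `(I/I²)_a` is
  finite projective, so `C_a` is formally smooth over `A_a` and over `R`, the Jacobi–Zariski
  sequence `0 → C_a ⊗ Ω_{A_a/R} → Ω_{C_a/R} → Ω_{C_a/A_a} → 0` (Mathlib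
  `KaehlerDifferential.exact_mapBaseChange_map`, `H1Cotangent.exact_δ_mapBaseChange`) is split
  exact, and `Ω_{C_a/R} ≅ C_a ⊗_{A_a} ((A_a ⊗ Ω_{A/R}) ⊕ (I/I²)_a)` is free.

## References

* The Stacks Project, *Smoothing Ring Maps* (Tag 07BW): Lemma 07CE (16.3.1) and its proof; proof
  of Lemma 07FE. [StacksProject]
* R. Elkik, *Solutions d'équations à coefficients dans un anneau hensélien*, Ann. Sci. ÉNS 6
  (1973) 553–603 ("Some of the results in this section are due to Elkik", Stacks §07CD).
  [cited through StacksProject]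
-/

noncomputable section

open MvPolynomial TensorProduct

namespace Literature.AlgebraicGeometry.Resolution

universe u


/-! ## I. Symmetric algebras: finiteness, smoothness and differentials -/

namespace SymAlg

section Generic

variable {S : Type u} [CommRing S] {N : Type u} [AddCommGroup N] [Module S N]
  {A : Type u} [CommRing A] [Algebra S A] {f : N →ₗ[S] A}

/-- A symmetric algebra of `N` is generated by the image of `N`. [folklore] -/
theorem adjoin_range_eq_top (h : IsSymmetricAlgebra f) : Algebra.adjoin S (Set.range f) = ⊤ := by
  refine Algebra.eq_top_iff.mpr fun a => ?_
  induction a using h.induction with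
  | algebraMap r => exact Subalgebra.algebraMap_mem _ r
  | ι x => exact Algebra.subset_adjoin ⟨x, rfl⟩
  | mul a b ha hb => exact Subalgebra.mul_mem _ ha hb
  | add a b ha hb => exact Subalgebra.add_mem _ ha hb

/-- A symmetric algebra of a finite module is of finite type. [folklore] -/
theorem finiteType (h : IsSymmetricAlgebra f) [Module.Finite S N] : Algebra.FiniteType S A := by
  classical
  obtain ⟨s, hs⟩ := Module.Finite.fg_top (R := S) (M := N)
  refine ⟨⟨s.image f, ?_⟩⟩
  rw [Finset.coe_image]
  refine Algebra.eq_top_iff.mpr fun a => ?_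
  have hsub : ∀ x : N, f x ∈ Algebra.adjoin S (f '' ↑s) := by
    intro x
    have hx : x ∈ Submodule.span S (↑s : Set N) := by rw [hs]; exact Submodule.mem_top
    have := Submodule.apply_mem_span_image_of_mem_span f hx
    exact (Submodule.span_le.mpr (fun y hy => Algebra.subset_adjoin hy) :
      Submodule.span S (f '' ↑s) ≤ Subalgebra.toSubmodule (Algebra.adjoin S (f '' ↑s))) this
  induction a using h.induction with
  | algebraMap r => exact Subalgebra.algebraMap_mem _ r
  | ι x => exact hsub x
  | mul a b ha hb => exact Subalgebra.mul_mem _ ha hb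
  | add a b ha hb => exact Subalgebra.add_mem _ ha hb

/-- The linear map `S^k → S[X_1, …, X_k]`, `w ↦ ∑ w_j X_j`. [folklore] -/
abbrev linPol (S : Type u) [CommRing S] (k : ℕ) : (Fin k → S) →ₗ[S] MvPolynomial (Fin k) S :=
  Fintype.linearCombination S (MvPolynomial.X : Fin k → MvPolynomial (Fin k) S)

/-- `linPol e_j = X_j`. [folklore] -/
theorem linPol_single (k : ℕ) (j : Fin k) : linPol S k (Pi.single j 1) = MvPolynomial.X j := by
  classical
  rw [linPol, Fintype.linearCombination_apply_single, one_smul]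

/-- **A symmetric algebra of a finite projective module is a retract of a polynomial algebra**:
if `N` is a direct summand of `S^k` (`π ∘ σ = id`) then `A = Sym(N) → S[X_1, …, X_k] → A`
composes to the identity. [folklore] -/
theorem exists_retract_mvPolynomial (h : IsSymmetricAlgebra f) {k : ℕ}
    (π : (Fin k → S) →ₗ[S] N) (σ : N →ₗ[S] (Fin k → S)) (hπσ : π ∘ₗ σ = LinearMap.id) :
    (MvPolynomial.aeval fun j => f (π (Pi.single j 1)) : MvPolynomial (Fin k) S →ₐ[S] A).comp
      (h.lift (linPol S k ∘ₗ σ)) = AlgHom.id S A := by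
  classical
  refine h.algHom_ext (LinearMap.ext fun x => ?_)
  change (MvPolynomial.aeval _) (h.lift (linPol S k ∘ₗ σ) (f x)) = f x
  rw [IsSymmetricAlgebra.lift_eq, LinearMap.comp_apply, Fintype.linearCombination_apply, map_sum]
  simp_rw [map_smul, MvPolynomial.aeval_X, ← LinearMap.map_smul, ← map_sum]
  have hsum : ∑ j, σ x j • (Pi.single j (1 : S) : Fin k → S) = σ x := by
    ext i
    simp [Finset.sum_apply, Pi.single_apply]
  rw [hsum]
  exact congrArg f (LinearMap.congr_fun hπσ x)

/-- A symmetric algebra of a finite projective module is formally smooth (it is a retract of a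
polynomial algebra). [folklore] -/
theorem formallySmooth (h : IsSymmetricAlgebra f) [Module.Finite S N] [Module.Projective S N] :
    Algebra.FormallySmooth S A := by
  obtain ⟨k, π, hπ⟩ := Module.Finite.exists_fin' S N
  obtain ⟨σ, hσ⟩ := Module.projective_lifting_property π LinearMap.id hπ
  exact formallySmooth_of_retract (h.lift (linPol S k ∘ₗ σ))
    (MvPolynomial.aeval fun j => f (π (Pi.single j 1))) (exists_retract_mvPolynomial h π σ hσ)

/-- Evaluating `∑ w_j X_j` at `X_j ↦ f(π e_j)` gives `f(π w)`. [folklore] -/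
theorem aeval_linPol {k : ℕ} (π : (Fin k → S) →ₗ[S] N) (w : Fin k → S) :
    (MvPolynomial.aeval fun j => f (π (Pi.single j 1)) : MvPolynomial (Fin k) S →ₐ[S] A)
      (linPol S k w) = f (π w) := by
  classical
  rw [Fintype.linearCombination_apply, map_sum]
  simp_rw [map_smul, MvPolynomial.aeval_X, ← LinearMap.map_smul, ← map_sum]
  have hsum : ∑ j, w j • (Pi.single j (1 : S) : Fin k → S) = w := by
    ext i
    simp [Finset.sum_apply, Pi.single_apply]
  rw [hsum]

variable (f) in
/-- The map `A ⊗_S N → Ω_{A/S}`, `a ⊗ n ↦ a d(f n)`. [folklore] -/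
abbrev toKaehler : A ⊗[S] N →ₗ[A] Ω[A⁄S] :=
  LinearMap.liftBaseChange A ((KaehlerDifferential.D S A).toLinearMap ∘ₗ f)

/-- Formula for `toKaehler` on pure tensors. [folklore] -/
theorem toKaehler_tmul (a : A) (n : N) :
    toKaehler f (a ⊗ₜ n) = a • KaehlerDifferential.D S A (f n) := by
  rw [toKaehler, LinearMap.liftBaseChange_tmul]
  rfl

/-- For the polynomial algebra `S[X_1, …, X_k] = Sym(S^k)`, `a ⊗ e_j ↦ a dX_j` is bijective.
[folklore] -/
theorem toKaehler_linPol_bijective (k : ℕ) :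
    Function.Bijective (toKaehler (linPol S k)) := by
  classical
  let bF := (Pi.basisFun S (Fin k)).baseChange (MvPolynomial (Fin k) S)
  let e := bF.equiv (KaehlerDifferential.mvPolynomialBasis S (Fin k)) (Equiv.refl _)
  suffices toKaehler (linPol S k) = e.toLinearMap by rw [this]; exact e.bijective
  refine bF.ext fun j => ?_
  rw [LinearEquiv.coe_coe, Module.Basis.equiv_apply, Equiv.refl_apply,
    KaehlerDifferential.mvPolynomialBasis_apply]
  change toKaehler (linPol S k) ((Pi.basisFun S (Fin k)).baseChange _ j) = _
  rw [Module.Basis.baseChange_apply, Pi.basisFun_apply, toKaehler_tmul, linPol_single, one_smul]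

set_option maxHeartbeats 400000 in
/-- **Differentials of a symmetric algebra**: for a symmetric algebra `A` of a finite
projective `S`-module `N`, `A ⊗_S N → Ω_{A/S}`, `a ⊗ n ↦ a d(f n)` is bijective (i.e.
`Ω_{Sym(N)/S} ≅ Sym(N) ⊗_S N`). Proof: both sides are retracts of the corresponding objects for
`S[X_1, …, X_k] = Sym(S^k)`, compatibly, and there the map is the bijection `e_j ↦ dX_j`.
[folklore] -/
theorem toKaehler_bijective (h : IsSymmetricAlgebra f) [Module.Finite S N]
    [Module.Projective S N] : Function.Bijective (toKaehler f) := by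
  classical
  obtain ⟨k, π, hπ⟩ := Module.Finite.exists_fin' S N
  obtain ⟨σ, hσ⟩ := Module.projective_lifting_property π LinearMap.id hπ
  let Pol := MvPolynomial (Fin k) S
  let Φ : A →ₐ[S] Pol := h.lift (linPol S k ∘ₗ σ)
  let Ψ : Pol →ₐ[S] A := MvPolynomial.aeval fun j => f (π (Pi.single j 1))
  have hΨΦ : Ψ.comp Φ = AlgHom.id S A := exists_retract_mvPolynomial h π σ hσ
  have hΨΦ' : ∀ a, Ψ (Φ a) = a := fun a => AlgHom.congr_fun hΨΦ a
  have hΦf : ∀ n, Φ (f n) = linPol S k (σ n) := fun n => h.lift_eq _ n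
  have hΨlin : ∀ w, Ψ (linPol S k w) = f (π w) := aeval_linPol π
  -- the two algebra structures `A → Pol → A`
  letI iAP : Algebra A Pol := Φ.toRingHom.toAlgebra
  letI iPA : Algebra Pol A := Ψ.toRingHom.toAlgebra
  haveI : IsScalarTower S A Pol := IsScalarTower.of_algebraMap_eq fun x => (Φ.commutes x).symm
  haveI : IsScalarTower S Pol A := IsScalarTower.of_algebraMap_eq fun x => (Ψ.commutes x).symm
  let u : Ω[A⁄S] →ₗ[A] Ω[Pol⁄S] := KaehlerDifferential.map S S A Pol
  let v : Ω[Pol⁄S] →ₗ[Pol] Ω[A⁄S] := KaehlerDifferential.map S S Pol A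
  have hu : ∀ a, u (KaehlerDifferential.D S A a) = KaehlerDifferential.D S Pol (Φ a) := fun a =>
    KaehlerDifferential.map_D S S A Pol a
  have hv : ∀ p, v (KaehlerDifferential.D S Pol p) = KaehlerDifferential.D S A (Ψ p) := fun p =>
    KaehlerDifferential.map_D S S Pol A p
  have hvu : ∀ ω, v (u ω) = ω := by
    intro ω
    have hω : ω ∈ Submodule.span A (Set.range (KaehlerDifferential.D S A)) := by
      rw [KaehlerDifferential.span_range_derivation]; exact Submodule.mem_top
    induction hω using Submodule.span_induction with
    | mem x hx => obtain ⟨a, rfl⟩ := hx; rw [hu, hv, hΨΦ']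
    | zero => rw [map_zero, map_zero]
    | add x y _ _ hx hy => rw [map_add, map_add, hx, hy]
    | smul a x _ hx =>
      rw [map_smul]
      change v ((Φ a) • u x) = a • x
      rw [map_smul]
      change Ψ (Φ a) • v (u x) = a • x
      rw [hx, hΨΦ']
  -- the polynomial side
  let αP := toKaehler (linPol S k)
  have hαP := toKaehler_linPol_bijective (S := S) k
  -- retract maps on the tensor side
  let u' : A ⊗[S] N →ₗ[S] Pol ⊗[S] (Fin k → S) := TensorProduct.map Φ.toLinearMap σ
  let v' : Pol ⊗[S] (Fin k → S) →ₗ[S] A ⊗[S] N := TensorProduct.map Ψ.toLinearMap π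
  have hv'u' : ∀ x, v' (u' x) = x := by
    intro x
    rw [← LinearMap.comp_apply, ← TensorProduct.map_comp]
    have h1 : Ψ.toLinearMap ∘ₗ Φ.toLinearMap = LinearMap.id := by
      ext a; exact hΨΦ' a
    rw [h1, hσ, TensorProduct.map_id, LinearMap.id_apply]
  -- naturality
  have hN1 : ∀ x, αP (u' x) = u (toKaehler f x) := by
    intro x
    induction x using TensorProduct.induction_on with
    | zero => simp only [map_zero]
    | tmul a n =>
      rw [TensorProduct.map_tmul, toKaehler_tmul, toKaehler_tmul, map_smul, hu, hΦf]
      rfl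
    | add x y hx hy => rw [map_add, map_add, map_add, map_add, hx, hy]
  have hN2 : ∀ y, toKaehler f (v' y) = v (αP y) := by
    intro y
    induction y using TensorProduct.induction_on with
    | zero => simp only [map_zero]
    | tmul p w =>
      rw [TensorProduct.map_tmul, toKaehler_tmul, toKaehler_tmul, map_smul, hv, hΨlin]
      rfl
    | add x y hx hy => rw [map_add, map_add, map_add, map_add, hx, hy]
  constructor
  · intro x y hxy
    rw [← hv'u' x, ← hv'u' y]
    congr 1
    apply hαP.1
    rw [hN1, hN1, hxy]
  · intro ω
    obtain ⟨y, hy⟩ := hαP.2 (u ω)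
    exact ⟨v' y, by rw [hN2, hy, hvu]⟩

end Generic

section Localization

variable {B : Type u} [CommRing B] {M : Type u} [AddCommGroup M] [Module B M]
  {C : Type u} [CommRing C] [Algebra B C] {g : M →ₗ[B] C}
  (a : B) (B' : Type u) [CommRing B'] [Algebra B B'] [IsLocalization.Away a B']
  (C' : Type u) [CommRing C'] [Algebra C C'] [Algebra B C'] [IsScalarTower B C C']
  [IsLocalization.Away (algebraMap B C a) C'] [Algebra B' C'] [IsScalarTower B B' C']

variable (g) in
/-- The structure map `B_a ⊗_B M → C_a` of the localized symmetric algebra. [folklore] -/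
abbrev locMap : B' ⊗[B] M →ₗ[B'] C' :=
  LinearMap.liftBaseChange B' ((IsScalarTower.toAlgHom B C C').toLinearMap ∘ₗ g)

/-- Formula for `locMap` on pure tensors. [folklore] -/
theorem locMap_tmul (b : B') (m : M) :
    locMap g B' C' (b ⊗ₜ m) = b • algebraMap C C' (g m) := by
  rw [locMap, LinearMap.liftBaseChange_tmul]
  rfl

include a in
set_option maxHeartbeats 400000 in
/-- **Localizing a symmetric algebra**: if `C` is a symmetric algebra of the `B`-module `M`, then
`C_a` is a symmetric algebra of the `B_a`-module `B_a ⊗_B M` (symmetric algebras commute with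
the base change `B → B_a`). [folklore] -/
theorem isSymmetricAlgebra_locMap (hg : IsSymmetricAlgebra g) :
    IsSymmetricAlgebra (locMap g B' C') := by
  let M' := B' ⊗[B] M
  let Sym' := SymmetricAlgebra B' M'
  let ι' : M' →ₗ[B'] Sym' := SymmetricAlgebra.ι B' M'
  let θ : Sym' →ₐ[B'] C' := SymmetricAlgebra.lift (locMap g B' C')
  -- the inverse: first on `C`, then extended to `C_a`
  let κ₀ : C →ₐ[B] Sym' := hg.lift (ι'.restrictScalars B ∘ₗ TensorProduct.mk B B' M 1)
  have hκ₀g : ∀ m, κ₀ (g m) = ι' (1 ⊗ₜ m) := fun m => hg.lift_eq _ m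
  have hunit : ∀ y : Submonoid.powers (algebraMap B C a), IsUnit (κ₀ y) := by
    rintro ⟨y, n, rfl⟩
    rw [map_pow, AlgHom.commutes, IsScalarTower.algebraMap_apply B B' Sym']
    exact (IsUnit.map _ (IsLocalization.Away.algebraMap_isUnit a)).pow n
  let κ : C' →ₐ[B] Sym' := IsLocalization.liftAlgHom hunit
  have hκ : ∀ c, κ (algebraMap C C' c) = κ₀ c := fun c => IsLocalization.lift_eq hunit c
  -- `θ ∘ κ = id`
  have hθκ₀ : ∀ c, θ (κ₀ c) = algebraMap C C' c := by
    intro c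
    change (θ.restrictScalars B).comp κ₀ c = IsScalarTower.toAlgHom B C C' c
    congr 1
    refine hg.algHom_ext (LinearMap.ext fun m => ?_)
    change θ (κ₀ (g m)) = algebraMap C C' (g m)
    rw [hκ₀g, SymmetricAlgebra.lift_ι_apply, locMap_tmul, one_smul]
  have hθκ : ∀ x, θ (κ x) = x := by
    intro x
    have : θ.toRingHom.comp κ.toRingHom = RingHom.id C' := by
      refine IsLocalization.ringHom_ext (Submonoid.powers (algebraMap B C a)) ?_
      ext c
      simp only [RingHom.coe_comp, Function.comp_apply, RingHom.id_comp]
      change θ (κ (algebraMap C C' c)) = algebraMap C C' c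
      rw [hκ, hθκ₀]
    exact RingHom.congr_fun this x
  -- `κ` is `B_a`-linear
  have hκB' : κ.toRingHom.comp (algebraMap B' C') = algebraMap B' Sym' := by
    refine IsLocalization.ringHom_ext (Submonoid.powers a) ?_
    ext b
    simp only [RingHom.coe_comp, Function.comp_apply]
    rw [← IsScalarTower.algebraMap_apply, ← IsScalarTower.algebraMap_apply]
    exact κ.commutes b
  let κ' : C' →ₐ[B'] Sym' :=
    { κ.toRingHom with commutes' := fun b => RingHom.congr_fun hκB' b }
  -- `κ ∘ θ = id`
  have hκθ : κ'.comp θ = AlgHom.id B' Sym' := by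
    refine SymmetricAlgebra.algHom_ext ?_
    refine TensorProduct.AlgebraTensorModule.ext fun b m => ?_
    change κ' (θ (ι' (b ⊗ₜ m))) = ι' (b ⊗ₜ m)
    rw [SymmetricAlgebra.lift_ι_apply, locMap_tmul, map_smul]
    change b • κ (algebraMap C C' (g m)) = _
    rw [hκ, hκ₀g, ← map_smul, TensorProduct.smul_tmul', smul_eq_mul, mul_one]
  refine ⟨fun x y hxy => ?_, fun x => ⟨κ x, hθκ x⟩⟩
  have := congrArg κ' hxy
  rwa [← AlgHom.comp_apply, ← AlgHom.comp_apply, hκθ] at this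

end Localization

end SymAlg

/-! ## II. Stacks 07CE for the symmetric algebra of the conormal module -/

section ImprovePresentation

open SymAlg

variable {R B : Type u} [CommRing R] [CommRing B] [Algebra R B]
  {ι₀ : Type} (P : Algebra.Generators R B ι₀)
  {C : Type u} [CommRing C] [Algebra B C] [Algebra R C] [IsScalarTower R B C]
  {g : P.toExtension.Cotangent →ₗ[B] C}

/-- `C = Sym_B(I/I²)` is of finite type over `R` when `B` is finitely presented over `R`
(Stacks 07CE: "There exists a finite type `R`-algebra map `A → C`").
[cite: StacksProject, Tag 07CE] -/
theorem finiteType_of_isSymmetricAlgebra_cotangent [Finite ι₀] [Algebra.FinitePresentation R B]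
    (hg : IsSymmetricAlgebra g) : Algebra.FiniteType R C := by
  haveI : Module.Finite B P.toExtension.Cotangent :=
    Algebra.Extension.Cotangent.finite P.fg_ker_of_finitePresentation
  haveI : Algebra.FiniteType B C := finiteType hg
  exact Algebra.FiniteType.trans (S := B) inferInstance this

/-- … hence of finite presentation when `R` is Noetherian (Stacks 07CE: "if `R` is Noetherian,
then `C` is of finite presentation over `R`"). [cite: StacksProject, Tag 07CE] -/
theorem finitePresentation_of_isSymmetricAlgebra_cotangent [Finite ι₀] [IsNoetherianRing R]
    [Algebra.FinitePresentation R B] (hg : IsSymmetricAlgebra g) :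
    Algebra.FinitePresentation R C :=
  haveI := finiteType_of_isSymmetricAlgebra_cotangent P hg
  (Algebra.FinitePresentation.of_finiteType (R := R) (A := C)).mp this

/-- The retraction `C = Sym_B(I/I²) → B` (projection onto the degree `0` part; Stacks 07CE:
"which has a retraction"). [cite: StacksProject, Tag 07CE] -/
theorem exists_retraction_of_isSymmetricAlgebra (hg : IsSymmetricAlgebra g) :
    ∃ σ : C →ₐ[R] B, ∀ b : B, σ (algebraMap B C b) = b :=
  ⟨(hg.lift (0 : P.toExtension.Cotangent →ₗ[B] B)).restrictScalars R, fun b => by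
    change hg.lift 0 (algebraMap B C b) = b
    rw [AlgHom.commutes]
    rfl⟩

set_option maxHeartbeats 800000 in
set_option backward.isDefEq.respectTransparency false in
/-- **Stacks, Lemma 07CE (for `C = Sym_B(I/I²)`, smooth case of (1) and (2)).** Let `B` be an
`R`-algebra with generators `P` (kernel `I`) and let `C` be a symmetric algebra of the `B`-module
`I/I²`. If `a ∈ B` is such that `B_a` is formally smooth over `R`, then `C_a` is formally smooth
over `R` and `Ω_{C_a/R}` is a free `C_a`-module. Stacks: "(1) for each `a ∈ A` such that
`R → A_a` is a local complete intersection the ring `C_a` is smooth over `A_a` … (2) for each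
`a ∈ A` such that `A_a` is smooth over `R` the module `Ω_{C_a/R}` is free over `C_a`"; proof:
"`(I/I²)_a` is finite projective … `K_a ⊕ (I/I²)_a ≅ A_a^{⊕ m}` is free … the cokernel … is
the module `I/I² ⊗_A C_a ⊕ Ω_{A_a/R} ⊗_{A_a} C_a`. Since `(I/I²)_a ⊕ Ω_{A_a/R}` is free … (2)
holds." Here: `C_a` is a symmetric algebra of the finite projective `A_a`-module `(I/I²)_a`
(`isSymmetricAlgebra_locMap`), hence a retract of a polynomial algebra (formally smooth) with
`Ω_{C_a/A_a} ≅ C_a ⊗ (I/I²)_a` (`toKaehler_bijective`); the Jacobi–Zariski sequence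
`0 → C_a ⊗ Ω_{A_a/R} → Ω_{C_a/R} → Ω_{C_a/A_a} → 0` is split exact, and
`(I/I²)_a ⊕ Ω_{A_a/R} ≅ A_a^{⊕ n}` by the split conormal sequence of the smooth algebra `A_a`.
[cite: StacksProject, Tag 07CE] -/
theorem formallySmooth_and_free_of_isSymmetricAlgebra_cotangent [Finite ι₀]
    [Algebra.FinitePresentation R B] (hg : IsSymmetricAlgebra g) (a : B) [Algebra.FormallySmooth R (Localization.Away a)] :
    Algebra.FormallySmooth R (Localization.Away (algebraMap B C a)) ∧
      Module.Free (Localization.Away (algebraMap B C a))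
        (Ω[Localization.Away (algebraMap B C a)⁄R]) := by
  set B' := Localization.Away a with hB'
  set C' := Localization.Away (algebraMap B C a) with hC'
  -- `C_a` is a `B_a`-algebra
  have hux : IsUnit (algebraMap B C' a) := by
    rw [IsScalarTower.algebraMap_apply B C C']
    exact IsLocalization.Away.algebraMap_isUnit (algebraMap B C a)
  letI iB'C' : Algebra B' C' := (IsLocalization.Away.lift a hux).toAlgebra
  haveI : IsScalarTower B B' C' := IsScalarTower.of_algebraMap_eq fun b =>
    (IsLocalization.Away.lift_eq a hux b).symm
  haveI : IsScalarTower R B' C' := IsScalarTower.of_algebraMap_eq fun r => by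
    rw [IsScalarTower.algebraMap_apply R B C', IsScalarTower.algebraMap_apply R B B',
      ← IsScalarTower.algebraMap_apply B B' C']
  -- `C_a` is a symmetric algebra of the finite projective `B_a`-module `(I/I²)_a`
  have hIs := isSymmetricAlgebra_locMap a B' C' hg
  haveI : Module.Finite B P.toExtension.Cotangent :=
    Algebra.Extension.Cotangent.finite P.fg_ker_of_finitePresentation
  haveI hfree := Stacks07EZ.free_locCot_prod P a (R := R)
  haveI : Module.Projective B' (B' ⊗[B] P.toExtension.Cotangent) :=
    Module.Projective.of_split (LinearMap.inl B' _ (B' ⊗[B] (Ω[B⁄R]))) (LinearMap.fst B' _ _)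
      (LinearMap.ext fun _ => rfl)
  -- formal smoothness: `C_a` is a retract of a polynomial algebra over `B_a`
  haveI hfsB' : Algebra.FormallySmooth B' C' := formallySmooth hIs
  have hfsR : Algebra.FormallySmooth R C' := Algebra.FormallySmooth.comp R B' C'
  -- `Ω_{C_a/B_a} ≅ C_a ⊗ (I/I²)_a`
  let eΩ' : (C' ⊗[B'] (B' ⊗[B] P.toExtension.Cotangent)) ≃ₗ[C'] (Ω[C'⁄B']) :=
    LinearEquiv.ofBijective _ (toKaehler_bijective hIs)
  -- the Jacobi–Zariski sequence `0 → C_a ⊗ Ω_{B_a/R} → Ω_{C_a/R} → Ω_{C_a/B_a} → 0` splits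
  have hex := KaehlerDifferential.exact_mapBaseChange_map R B' C'
  have hsurj := KaehlerDifferential.map_surjective R B' C'
  have hinj : Function.Injective (KaehlerDifferential.mapBaseChange R B' C') := by
    have hδ := Algebra.H1Cotangent.exact_δ_mapBaseChange R B' C'
    rw [← LinearMap.ker_eq_bot, LinearMap.ker_eq_bot']
    intro y hy
    obtain ⟨z, rfl⟩ := (hδ y).mp hy
    rw [Subsingleton.elim z 0, map_zero]
  obtain ⟨sec, hsec⟩ := Module.projective_lifting_property
    (KaehlerDifferential.map R B' C' C') LinearMap.id hsurj
  have h02 := hex.split_tfae'.out 0 2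
  obtain ⟨e, -, -⟩ := h02.mp ⟨hinj, sec, hsec⟩
  -- `Ω_{B_a/R} ≅ B_a ⊗ Ω_{B/R}` and `(I/I²)_a ⊕ B_a ⊗ Ω_{B/R}` is free
  let eΩB : B' ⊗[B] (Ω[B⁄R]) ≃ₗ[B'] (Ω[B'⁄R]) :=
    (IsLocalizedModule.isBaseChange (Submonoid.powers a) B' (KaehlerDifferential.map R R B B')).equiv
  let e1 : (Ω[C'⁄R]) ≃ₗ[C'] C' ⊗[B']
      ((B' ⊗[B] P.toExtension.Cotangent) × (B' ⊗[B] (Ω[B⁄R]))) :=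
    e.trans ((((LinearEquiv.baseChange B' C' _ _ eΩB.symm).prodCongr eΩ'.symm).trans
      (TensorProduct.prodRight B' C' C' _ _).symm).trans
        (LinearEquiv.baseChange B' C' _ _ (LinearEquiv.prodComm B' _ _)))
  exact ⟨hfsR, Module.Free.of_equiv e1.symm⟩

/-- Smooth version over a Noetherian base: if `B_a` is smooth over `R` then so is `C_a`, and
`Ω_{C_a/R}` is free. [cite: StacksProject, Tag 07CE] -/
theorem smooth_and_free_of_isSymmetricAlgebra_cotangent [Finite ι₀] [IsNoetherianRing R]
    [Algebra.FinitePresentation R B] (hg : IsSymmetricAlgebra g) (a : B)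
    [Algebra.Smooth R (Localization.Away a)] :
    Algebra.Smooth R (Localization.Away (algebraMap B C a)) ∧
      Module.Free (Localization.Away (algebraMap B C a))
        (Ω[Localization.Away (algebraMap B C a)⁄R]) := by
  haveI : Algebra.FormallySmooth R (Localization.Away a) := Algebra.Smooth.formallySmooth
  obtain ⟨h1, h2⟩ := formallySmooth_and_free_of_isSymmetricAlgebra_cotangent P hg a
  haveI := finitePresentation_of_isSymmetricAlgebra_cotangent P hg
  haveI : Algebra.FinitePresentation C (Localization.Away (algebraMap B C a)) :=
    IsLocalization.Away.finitePresentation (algebraMap B C a)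
  exact ⟨⟨h1, .trans R C _⟩, h2⟩

/-- **Stacks, Lemma 07CE, packaged for the proof of Lemma 07FE.** For `B` of finite presentation
over a Noetherian ring `R` there is a finitely presented `R`-algebra `C` (namely
`C = Sym_B(I/I²)` for a finite presentation `B = R[x]/I`) with `R`-algebra maps `B → C → B`
composing to the identity, such that for every `a ∈ B` with `B_a` smooth over `R` the ring
`C_a` is smooth over `R` with `Ω_{C_a/R}` free over `C_a`. (07FE: "Let `B → C` be the
`R`-algebra map constructed in Lemma 07CE which comes with a `R`-algebra retraction `C → B`. …
By construction `C_{x_i}` is a smooth `R`-algebra with `Ω_{C_{x_i}/R}` free.")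
[cite: StacksProject, Tag 07CE] -/
theorem Stacks07CE_exists_symmetricAlgebra (R B : Type u) [CommRing R] [CommRing B] [Algebra R B]
    [IsNoetherianRing R] [Algebra.FinitePresentation R B] :
    ∃ (C : Type u) (_ : CommRing C) (_ : Algebra R C) (toC : B →ₐ[R] C) (σ : C →ₐ[R] B),
      Algebra.FinitePresentation R C ∧ (∀ b, σ (toC b) = b) ∧
      ∀ a : B, Algebra.Smooth R (Localization.Away a) →
        Algebra.Smooth R (Localization.Away (toC a)) ∧
          Module.Free (Localization.Away (toC a)) (Ω[Localization.Away (toC a)⁄R]) := by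
  let P := (Algebra.Presentation.ofFinitePresentation R B).toGenerators
  let C := SymmetricAlgebra B P.toExtension.Cotangent
  have hg : IsSymmetricAlgebra (SymmetricAlgebra.ι B P.toExtension.Cotangent) :=
    SymmetricAlgebra.isSymmetricAlgebra_ι
  haveI hfp : Algebra.FinitePresentation R C :=
    finitePresentation_of_isSymmetricAlgebra_cotangent P hg
  obtain ⟨σ, hσ⟩ := exists_retraction_of_isSymmetricAlgebra P hg (R := R)
  refine ⟨C, inferInstance, inferInstance, IsScalarTower.toAlgHom R B C, σ, hfp, hσ,
    fun a ha => ?_⟩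
  exact smooth_and_free_of_isSymmetricAlgebra_cotangent P hg a

end ImprovePresentation

end Literature.AlgebraicGeometry.Resolution

end

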